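import Summits.AtomisticToContinuum.Crystallization.Theorems.ChartedPlanarOrderPlanesEstimate
import Summits.AtomisticToContinuum.Crystallization.Theorems.OverbindingBudgetStackedRigidityW
import Summits.AtomisticToContinuum.Crystallization.Theorems.ChartedPlanarOrderStackedUniform
import Summits.AtomisticToContinuum.Crystallization.Theorems.OverbindingBudgetEnergyThinProfiles

/-!
# ★ Slot 7b PROVED: `GapStressVanishesW (17/16)` — a constant transmitted gap stress of a stress-free stacked configuration is zero
(decomp-a2c lens-3 g26, module P4 of the planes line; critic rows 519/523)

Blocker `N = ChartedPlanarOrder.ChartedZeroExcessLayered`; this is hypothesis `hV` of the cut of record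
`…ChartedPlanarOrderTubeChannelsBoxP.rdef_thirtyfirst_of_recordK_boxed_leafT` (def `…OverbindingBudgetStackedRigidityW.GapStressVanishesW`).

PROOF (method of planes).  Let `Y = Layered a b w` be stacked, `δ`-separated, `IsCleanW`, with in-plane periods `‖a‖, ‖b‖ ≤ 17/16`, and let
`gapStress a b m (incr w) = σ` for every gap `m`.  By `…StackedUniform.stackedUniform` there is a unit normal `ν ⊥ a, b` with all gap heights in
`[3/8, 23/20]` (`heights_band`); lens-4's `exists_short_step` / `exists_near_layered` give reduced layer shifts of length `≤ 23/20 + 17/16` and the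
covering radius `23/40 + 17/16 < 2`, whence `#(Y ∩ cube) ≥ (ℓ/4 − 2)³` (`…EnergyCubeCounting.card_ge_of_covering`, imported, not restated).  The final
inequality of the planes line (`…PlanesEstimate.planes_final`, tested against `v = σ`) reads `‖σ‖² W ≤ |𝒲(F)(ν, σ)| + ‖σ‖ E(ℓ, R)` with
`W ≥ (3/4) #F ≥ (3/4) ℓ³/512` and `E(ℓ, R) ≤ P ℓ³/R + Q_R ℓ²` (`ℓ ≥ δ`).  If `Y` is `StressFree`, polarisation (`virialForm_polar`, `virialForm_smul`)
and the quantitative contrapositive of `…PlanesVirialForm.not_stressFree_of_virial` (with `D₁₂ ≤ 250 δ⁻¹² · 27 ℓ³/δ³` from `dirSum_twelve_le`,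
`card_cube_le`) give `|𝒲(F)(ν, σ)| ≤ (1 + ‖σ‖)² c ℓ³ / 2` for every `c > 0` and all large cubes.  Choosing `c`, then `R`, then `ℓ` large
(`virial_dir_small`, the ε-bookkeeping in `gapStressVanishesW_holds`) contradicts `σ ≠ 0`.

Mathlib only (+ the lens-3 planes modules and lens-4's counting modules imported); `[folklore]`; no instances, no notation, sorry-free.
-/

noncomputable section

open Finset Metric
open scoped RealInnerProductSpace
open Summit.AtomisticToContinuum.Crystallization.Theorems.ChartedPlanarOrderRigidityDoor
open Summit.AtomisticToContinuum.Crystallization.Theorems.ChartedPlanarOrderDensityDichotomy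
open Summit.AtomisticToContinuum.Crystallization.Theorems.ChartedPlanarOrderMesoCut
open Summit.AtomisticToContinuum.Crystallization.Theorems.ChartedPlanarOrderProfileSlavingLJ (IsStacked gapStress incr)
open Summit.AtomisticToContinuum.Crystallization.Theorems.ChartedPlanarOrderDoorLayered (Layered)
open Summit.AtomisticToContinuum.Crystallization.Theorems.ChartedPlanarOrderNashForceBalance
open Summit.AtomisticToContinuum.Crystallization.Theorems.ChartedPlanarOrderSepCounting (exists_onb)
open Summit.AtomisticToContinuum.Crystallization.Theorems.ChartedPlanarOrderCleanStackedIndependent (finite_sep_inter_closedBall)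
open Summit.AtomisticToContinuum.Crystallization.Theorems.ChartedPlanarOrderCleanScaleP (IsCleanP)
open Summit.AtomisticToContinuum.Crystallization.Theorems.ChartedPlanarOrderStackedUniform (stackedUniform)
open Summit.AtomisticToContinuum.Crystallization.Theorems.OverbindingBudgetScaleWidening (IsCleanW)
open Summit.AtomisticToContinuum.Crystallization.Theorems.OverbindingBudgetElasticSplitShear (dirSum StressFree)
open Summit.AtomisticToContinuum.Crystallization.Theorems.OverbindingBudgetStackedRigidityW (GapStressVanishesW)
open Summit.AtomisticToContinuum.Crystallization.Theorems.OverbindingBudgetRegistryCut (IsUnitNormal)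
open Summit.AtomisticToContinuum.Crystallization.Theorems.OverbindingBudgetEnergyCubeCounting (card_ge_of_covering)
open Summit.AtomisticToContinuum.Crystallization.Theorems.OverbindingBudgetEnergyThinProfiles (exists_near_layered exists_short_step)
open Summit.AtomisticToContinuum.Crystallization.Theorems.ChartedPlanarOrderPlanesVirialForm (virialForm virialForm_polar not_stressFree_of_virial)
open Summit.AtomisticToContinuum.Crystallization.Theorems.ChartedPlanarOrderPlanesCount (dirSum_twelve_le card_cube_le)
open Summit.AtomisticToContinuum.Crystallization.Theorems.ChartedPlanarOrderPlanesCollar (cube)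
open Summit.AtomisticToContinuum.Crystallization.Theorems.ChartedPlanarOrderPlanesColumn (Lam Lam_nonneg virialForm_smul)
open Summit.AtomisticToContinuum.Crystallization.Theorems.ChartedPlanarOrderPlanesVirial (PhiMax C2 PhiMax_nonneg C2_nonneg)
open Summit.AtomisticToContinuum.Crystallization.Theorems.ChartedPlanarOrderPlanesEstimate (Err planes_final)

namespace Summit.AtomisticToContinuum.Crystallization.Theorems.ChartedPlanarOrderGapStressVanishes

variable {δ : ℝ} {a b : E3} {w : ℤ → E3}

/-! ## 1. Geometry of clean stacked configurations (from `stackedUniform`) -/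

/-- the unit normal and the height band `[3/8, 23/20]` (T: `[192/425, 404/375]·‖a‖`, S: `[8/17, 24/25]·‖a‖`, `27/32 ≤ ‖a‖ ≤ 17/16`). -/
theorem heights_band (hδ : 0 < δ) (hS : IsSep δ (Layered a b w)) (hc : IsCleanW (μS (Layered a b w))) (hst : IsStacked a b w)
    (ha : ‖a‖ ≤ 17 / 16) (hb : ‖b‖ ≤ 17 / 16) :
    ∃ ν : E3, ‖ν‖ = 1 ∧ ⟪ν, a⟫ = 0 ∧ ⟪ν, b⟫ = 0 ∧
      ∀ j : ℤ, 3 / 8 ≤ ⟪ν, w (j + 1) - w j⟫ ∧ ⟪ν, w (j + 1) - w j⟫ ≤ 23 / 20 := by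
  have hc' : IsCleanP (103 / 100) (μS (Layered a b w)) := hc
  obtain ⟨ν, hν1, hνa, hνb, -, ha0, -, -, hTS⟩ :=
    stackedUniform (by norm_num : (103 / 100 : ℝ) ≤ 8 / 7) hδ hS hc' hst ha hb
  refine ⟨ν, hν1, hνa, hνb, fun j => ?_⟩
  rcases hTS with ⟨-, hw⟩ | ⟨-, hw⟩
  · obtain ⟨h1, h2⟩ := hw j
    constructor <;> nlinarith [ha0, ha]
  · obtain ⟨h1, h2⟩ := hw j
    constructor <;> nlinarith [ha0, ha]

/-- a cube chunk of a separated configuration is a finite set. -/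
theorem exists_chunk {Y : Set E3} (hδ : 0 < δ) (hS : IsSep δ Y) (c : E3) {ℓ : ℝ} (hℓ : 0 ≤ ℓ) :
    ∃ F : Finset E3, (↑F : Set E3) = Y ∩ cube c ℓ := by
  have hfin : (Y ∩ cube c ℓ).Finite := by
    refine (finite_sep_inter_closedBall hδ hS c (3 * ℓ)).subset ?_
    rintro z ⟨hzY, hz⟩
    refine ⟨hzY, ?_⟩
    rw [Metric.mem_closedBall, EuclideanSpace.dist_eq]
    have hi : ∀ i, dist (z i) (c i) ^ 2 ≤ ℓ ^ 2 := by
      intro i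
      rw [Real.dist_eq]
      have h := hz i
      have habs : |z i - c i| ≤ ℓ := by
        rw [abs_le]
        constructor <;> linarith [h.1, h.2]
      nlinarith [abs_nonneg (z i - c i)]
    calc √(∑ i, dist (z i) (c i) ^ 2) ≤ √(∑ _i : Fin 3, ℓ ^ 2) := Real.sqrt_le_sqrt (Finset.sum_le_sum fun i _ => hi i)
      _ = √(3 * ℓ ^ 2) := by simp
      _ ≤ √((3 * ℓ) ^ 2) := Real.sqrt_le_sqrt (by nlinarith)
      _ = 3 * ℓ := Real.sqrt_sq (by linarith)
  exact ⟨hfin.toFinset, hfin.coe_toFinset⟩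

/-! ## 2. `StressFree`, quantitatively -/

/-- the quantitative contrapositive of `…PlanesVirialForm.not_stressFree_of_virial`. -/
theorem virial_small_of_stressFree {Y : Set E3} (hSF : StressFree Y) (u : E3) (hu : ‖u‖ = 1) {c C : ℝ} (hc : 0 < c) (hC : 0 < C) :
    ∃ ℓ₀ : ℝ, ∀ ℓ : ℝ, ℓ₀ ≤ ℓ → 0 < ℓ → ∀ (c₀ : E3) (F : Finset E3), (↑F : Set E3) = Y ∩ cube c₀ ℓ →
      dirSum 12 u F ≤ C * ℓ ^ 3 → |virialForm F u u| < c * ℓ ^ 3 := by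
  by_contra h
  refine not_stressFree_of_virial Y u hu hc hC (fun ℓ₀ => ?_) hSF
  by_contra h'
  apply h
  refine ⟨ℓ₀, fun ℓ hℓ hℓpos c₀ F hF hD => ?_⟩
  by_contra h''
  exact h' ⟨ℓ, hℓ, hℓpos, c₀, F, hF, not_lt.mp h'', hD⟩

/-- ★ along ANY vector `x`: eventually `|𝒲(F)(x, x)| ≤ ‖x‖² c ℓ³` on all cube chunks (`D₁₂ ≤ 250 δ⁻¹² · 27 ℓ³/δ³` for `ℓ ≥ δ`; homogeneity). -/
theorem virial_dir_small {Y : Set E3} (hδ : 0 < δ) (hS : IsSep δ Y) (hSF : StressFree Y) (x : E3) {c : ℝ} (hc : 0 < c) :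
    ∃ ℓ₀ : ℝ, ∀ ℓ : ℝ, ℓ₀ ≤ ℓ → ∀ (c₀ : E3) (F : Finset E3), (↑F : Set E3) = Y ∩ cube c₀ ℓ →
      |virialForm F x x| ≤ ‖x‖ ^ 2 * (c * ℓ ^ 3) := by
  by_cases hx : x = 0
  · refine ⟨0, fun ℓ hℓ c₀ F _ => ?_⟩
    have h0 : virialForm F 0 0 = 0 := by simpa using virialForm_smul F 0 0 (0 : E3) (0 : E3)
    rw [hx, h0, abs_zero]
    exact mul_nonneg (sq_nonneg _) (mul_nonneg hc.le (pow_nonneg hℓ 3))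
  · have hxn : 0 < ‖x‖ := norm_pos_iff.mpr hx
    obtain ⟨u, hudef⟩ : ∃ u : E3, u = ‖x‖⁻¹ • x := ⟨_, rfl⟩
    have hu : ‖u‖ = 1 := by rw [hudef, norm_smul, norm_inv, norm_norm, inv_mul_cancel₀ hxn.ne']
    have hxu : x = ‖x‖ • u := by rw [hudef, smul_smul, mul_inv_cancel₀ hxn.ne', one_smul]
    obtain ⟨ℓ₁, hℓ₁⟩ := virial_small_of_stressFree hSF u hu hc (C := 250 * δ⁻¹ ^ 12 * (27 / δ ^ 3)) (by positivity)
    refine ⟨max ℓ₁ δ, fun ℓ hℓ c₀ F hF => ?_⟩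
    have hℓ₁' : ℓ₁ ≤ ℓ := (le_max_left _ _).trans hℓ
    have hℓδ : δ ≤ ℓ := (le_max_right _ _).trans hℓ
    have hℓpos : 0 < ℓ := hδ.trans_le hℓδ
    have hFY : ∀ z ∈ F, z ∈ Y := fun z hz => by
      have h : z ∈ (↑F : Set E3) := hz
      rw [hF] at h
      exact h.1
    have hD : dirSum 12 u F ≤ 250 * δ⁻¹ ^ 12 * (27 / δ ^ 3) * ℓ ^ 3 := by
      have h1 := dirSum_twelve_le u hu F hδ (fun z hz w' hw hzw => hS z (hFY z hz) w' (hFY w' hw) hzw)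
      have h2 : (F.card : ℝ) ≤ (2 * ℓ / δ + 1) ^ 3 := card_cube_le Y hδ hS c₀ hℓpos.le F hF
      have h3 : (2 * ℓ / δ + 1) ^ 3 ≤ 27 / δ ^ 3 * ℓ ^ 3 := by
        have h4 : 2 * ℓ / δ + 1 ≤ 3 * ℓ / δ := by
          have := (one_le_div hδ).mpr hℓδ
          have e1 : 3 * ℓ / δ = 2 * ℓ / δ + ℓ / δ := by ring
          linarith
        calc (2 * ℓ / δ + 1) ^ 3 ≤ (3 * ℓ / δ) ^ 3 := pow_le_pow_left₀ (by positivity) h4 3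
          _ = 27 / δ ^ 3 * ℓ ^ 3 := by ring
      calc dirSum 12 u F ≤ 250 * δ⁻¹ ^ 12 * (F.card : ℝ) := h1
        _ ≤ 250 * δ⁻¹ ^ 12 * (27 / δ ^ 3 * ℓ ^ 3) := mul_le_mul_of_nonneg_left (h2.trans h3) (by positivity)
        _ = _ := by ring
    have key := hℓ₁ ℓ hℓ₁' hℓpos c₀ F hF hD
    have hW : virialForm F x x = ‖x‖ * ‖x‖ * virialForm F u u := by
      conv_lhs => rw [hxu]
      exact virialForm_smul F ‖x‖ ‖x‖ u u
    rw [hW, abs_mul, abs_of_nonneg (by positivity : 0 ≤ ‖x‖ * ‖x‖), sq]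
    exact mul_le_mul_of_nonneg_left key.le (by positivity)

/-! ## 3. ★★★ Slot 7b -/

/-- ★★★ **`GapStressVanishesW (17/16)`** — hypothesis `hV` of the cut of record: a constant transmitted gap stress of a clean, stress-free,
stacked configuration with in-plane periods `≤ 17/16` vanishes (the `IsNash` binder is not used). -/
theorem gapStressVanishesW_holds : GapStressVanishesW (17 / 16) := by
  intro δ hδ a b w hst hab ha hb hS hW _hN hSF σ hσ
  by_contra hσ0
  have hs : 0 < ‖σ‖ := norm_pos_iff.mpr hσ0
  -- geometry
  obtain ⟨ν, hν, hνa, hνb, hH⟩ := heights_band hδ hS hW hst ha hb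
  obtain ⟨e, he⟩ := exists_onb hν
  have hn : IsUnitNormal a b ν := ⟨hν, hνa, hνb⟩
  have hband : ∀ m : ℤ, 3 / 8 ≤ ⟪incr w m, ν⟫ ∧ ⟪incr w m, ν⟫ ≤ 23 / 20 := fun m => by
    have h := hH (m - 1)
    rw [sub_add_cancel] at h
    rw [real_inner_comm]
    exact h
  obtain ⟨R', hR'⟩ : ∃ R' : ℝ, R' = 23 / 20 + 17 / 16 := ⟨_, rfl⟩
  have hR'0 : 0 ≤ R' := by rw [hR']; norm_num
  have hshift : ∀ j : ℤ, ∃ p q : ℤ, ‖(w (j + 1) - w j) + (((p : ℝ) • a) + ((q : ℝ) • b))‖ ≤ R' := fun j => by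
    obtain ⟨g, ⟨p, q, rfl⟩, hg⟩ := exists_short_step hab hn hband j
    refine ⟨p, q, ?_⟩
    have e1 : (w (j + 1) - w j) + (((p : ℝ) • a) + ((q : ℝ) • b)) = (((p : ℝ) • a) + ((q : ℝ) • b)) + (w (j + 1) - w j) :=
      add_comm _ _
    rw [e1, hR']
    linarith
  have hcov : ∀ x : E3, ∃ p ∈ Layered a b w, dist x p ≤ 23 / 40 + 17 / 16 := fun x => by
    obtain ⟨p, hp, hd⟩ := exists_near_layered hab hn hband x
    exact ⟨p, hp, hd.trans (by linarith)⟩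
  -- constants
  have hΦ := PhiMax_nonneg hδ (by norm_num : (0 : ℝ) ≤ 3 / 8)
  have hC2 := C2_nonneg hδ (by norm_num : (0 : ℝ) ≤ 3 / 8) (by norm_num : (0 : ℝ) ≤ 23 / 20)
  have hLam := Lam_nonneg hδ
  obtain ⟨A, hA⟩ : ∃ A : ℝ, A = ‖σ‖ ^ 2 / 2048 := ⟨_, rfl⟩
  have hApos : 0 < A := by rw [hA]; positivity
  obtain ⟨c, hc⟩ : ∃ c : ℝ, c = 2 * A / (1 + ‖σ‖) ^ 2 := ⟨_, rfl⟩
  have hcpos : 0 < c := by rw [hc]; positivity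
  obtain ⟨P, hP⟩ : ∃ P : ℝ, P = 27 / δ ^ 3 * (2 * δ * Lam δ + 23 / 10 * C2 δ (3 / 8) (23 / 20)) := ⟨_, rfl⟩
  have hP0 : 0 ≤ P := by rw [hP]; positivity
  obtain ⟨R, hR⟩ : ∃ R : ℝ, R = max (2 * δ) (‖σ‖ * P / A) := ⟨_, rfl⟩
  have hRδ : 2 * δ ≤ R := by rw [hR]; exact le_max_left _ _
  have hRpos : 0 < R := by linarith
  have hRP : ‖σ‖ * P / R ≤ A := by
    rw [div_le_iff₀ hRpos]
    have h1 : ‖σ‖ * P / A ≤ R := by rw [hR]; exact le_max_right _ _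
    rw [div_le_iff₀ hApos] at h1
    linarith
  obtain ⟨s₀, hs₀⟩ : ∃ s₀ : ℕ, s₀ = ⌊R / (3 / 8)⌋₊ := ⟨_, rfl⟩
  have hs₀R : R < 3 / 8 * ((s₀ : ℝ) + 1) := by
    have h1 := Nat.lt_floor_add_one (R / (3 / 8))
    rw [← hs₀, div_lt_iff₀ (by norm_num : (0 : ℝ) < 3 / 8)] at h1
    linarith
  obtain ⟨Q, hQ⟩ : ∃ Q : ℝ, Q = 9 / δ ^ 2 * (6 * Lam δ * (2 * R / δ + 1) +
      48 * (s₀ : ℝ) ^ 3 * (23 / 20) * PhiMax δ (3 / 8) * (2 * R' / δ + 1)) := ⟨_, rfl⟩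
  have hQ0 : 0 ≤ Q := by rw [hQ]; positivity
  -- stress-freeness in the two polarisation directions, and the scale
  obtain ⟨ℓp, hℓp⟩ := virial_dir_small hδ hS hSF (ν + σ) hcpos
  obtain ⟨ℓm, hℓm⟩ := virial_dir_small hδ hS hSF (ν - σ) hcpos
  obtain ⟨ℓ, hℓ⟩ : ∃ ℓ : ℝ, ℓ = max (max ℓp ℓm) (max 16 (max δ (‖σ‖ * Q / A + 1))) := ⟨_, rfl⟩
  have hℓp' : ℓp ≤ ℓ := by rw [hℓ]; exact le_trans (le_max_left _ _) (le_max_left _ _)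
  have hℓm' : ℓm ≤ ℓ := by rw [hℓ]; exact le_trans (le_max_right _ _) (le_max_left _ _)
  have h16 : 16 ≤ ℓ := by rw [hℓ]; exact le_trans (le_max_left _ _) (le_max_right _ _)
  have hℓδ : δ ≤ ℓ := by rw [hℓ]; exact le_trans (le_trans (le_max_left _ _) (le_max_right _ _)) (le_max_right _ _)
  have hℓQ : ‖σ‖ * Q / A + 1 ≤ ℓ := by
    rw [hℓ]; exact le_trans (le_trans (le_max_right _ _) (le_max_right _ _)) (le_max_right _ _)
  have hℓpos : 0 < ℓ := by linarith
  -- the chunk at the origin; planes; density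
  obtain ⟨F, hF⟩ := exists_chunk hδ hS (0 : E3) hℓpos.le
  obtain ⟨W, hW1, -, hmain⟩ := planes_final hδ hS hab hν hνa hνb (by norm_num : (0 : ℝ) < 3 / 8) (by norm_num : (0 : ℝ) < 23 / 20)
    hH e he hRδ hs₀R hR'0 hshift σ hσ hℓpos.le F hF σ
  have hcard : ℓ ^ 3 / 512 ≤ (F.card : ℝ) := by
    have h1 := card_ge_of_covering (c := 0) (ℓ := ℓ) (by norm_num : (23 / 40 + 17 / 16 : ℝ) < 2) hcov (by linarith) hF
    have h2 : ℓ / 8 ≤ ℓ / 4 - 2 := by linarith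
    have h3 : (ℓ / 8) ^ 3 ≤ (ℓ / 4 - 2) ^ 3 := pow_le_pow_left₀ (by positivity) h2 3
    have h4 : (ℓ / 8) ^ 3 = ℓ ^ 3 / 512 := by ring
    linarith
  -- the error budget at scale `ℓ ≥ δ`
  have hErr : Err δ (3 / 8) (23 / 20) R R' ℓ s₀ ≤ P * ℓ ^ 3 / R + Q * ℓ ^ 2 := by
    have hX : 2 * ℓ / δ + 1 ≤ 3 * ℓ / δ := by
      have := (one_le_div hδ).mpr hℓδ
      have e1 : 3 * ℓ / δ = 2 * ℓ / δ + ℓ / δ := by ring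
      linarith
    have hX0 : 0 ≤ 2 * ℓ / δ + 1 := by positivity
    have hX3 : (2 * ℓ / δ + 1) ^ 3 ≤ 27 * ℓ ^ 3 / δ ^ 3 := (pow_le_pow_left₀ hX0 hX 3).trans (le_of_eq (by ring))
    have hX2 : (2 * ℓ / δ + 1) ^ 2 ≤ 9 * ℓ ^ 2 / δ ^ 2 := (pow_le_pow_left₀ hX0 hX 2).trans (le_of_eq (by ring))
    have t1 : Lam δ * ((2 * ℓ / δ + 1) ^ 3 * (2 * δ / R)) ≤ Lam δ * ((27 * ℓ ^ 3 / δ ^ 3) * (2 * δ / R)) :=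
      mul_le_mul_of_nonneg_left (mul_le_mul_of_nonneg_right hX3 (by positivity)) hLam
    have t2 : Lam δ * (6 * ((2 * ℓ / δ + 1) ^ 2 * (2 * R / δ + 1))) ≤ Lam δ * (6 * ((9 * ℓ ^ 2 / δ ^ 2) * (2 * R / δ + 1))) :=
      mul_le_mul_of_nonneg_left (mul_le_mul_of_nonneg_left (mul_le_mul_of_nonneg_right hX2 (by positivity)) (by norm_num)) hLam
    have t3 : C2 δ (3 / 8) (23 / 20) / R * (2 * (23 / 20) * (2 * ℓ / δ + 1) ^ 3) ≤
        C2 δ (3 / 8) (23 / 20) / R * (2 * (23 / 20) * (27 * ℓ ^ 3 / δ ^ 3)) :=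
      mul_le_mul_of_nonneg_left (mul_le_mul_of_nonneg_left hX3 (by norm_num)) (div_nonneg hC2 hRpos.le)
    have t4 : 8 * (s₀ : ℝ) ^ 3 * (23 / 20) * PhiMax δ (3 / 8) * (6 * ((2 * ℓ / δ + 1) ^ 2 * (2 * R' / δ + 1))) ≤
        8 * (s₀ : ℝ) ^ 3 * (23 / 20) * PhiMax δ (3 / 8) * (6 * ((9 * ℓ ^ 2 / δ ^ 2) * (2 * R' / δ + 1))) :=
      mul_le_mul_of_nonneg_left (mul_le_mul_of_nonneg_left (mul_le_mul_of_nonneg_right hX2 (by positivity)) (by norm_num))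
        (by positivity)
    calc Err δ (3 / 8) (23 / 20) R R' ℓ s₀ = Lam δ * ((2 * ℓ / δ + 1) ^ 3 * (2 * δ / R)) +
          Lam δ * (6 * ((2 * ℓ / δ + 1) ^ 2 * (2 * R / δ + 1))) + C2 δ (3 / 8) (23 / 20) / R * (2 * (23 / 20) * (2 * ℓ / δ + 1) ^ 3) +
            8 * (s₀ : ℝ) ^ 3 * (23 / 20) * PhiMax δ (3 / 8) * (6 * ((2 * ℓ / δ + 1) ^ 2 * (2 * R' / δ + 1))) := by
          unfold Err
          ring
      _ ≤ Lam δ * ((27 * ℓ ^ 3 / δ ^ 3) * (2 * δ / R)) + Lam δ * (6 * ((9 * ℓ ^ 2 / δ ^ 2) * (2 * R / δ + 1))) +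
          C2 δ (3 / 8) (23 / 20) / R * (2 * (23 / 20) * (27 * ℓ ^ 3 / δ ^ 3)) +
            8 * (s₀ : ℝ) ^ 3 * (23 / 20) * PhiMax δ (3 / 8) * (6 * ((9 * ℓ ^ 2 / δ ^ 2) * (2 * R' / δ + 1))) := by
          linarith [t1, t2, t3, t4]
      _ = P * ℓ ^ 3 / R + Q * ℓ ^ 2 := by
          rw [hP, hQ]
          ring
  -- polarisation: `|𝒲(F)(ν, σ)| ≤ A ℓ³`
  have hWνσ : |virialForm F ν σ| ≤ A * ℓ ^ 3 := by
    have hWp := hℓp ℓ hℓp' 0 F hF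
    have hWm := hℓm ℓ hℓm' 0 F hF
    have hcl : 0 ≤ c * ℓ ^ 3 := by positivity
    have hnp : ‖ν + σ‖ ^ 2 ≤ (1 + ‖σ‖) ^ 2 :=
      pow_le_pow_left₀ (norm_nonneg _) ((norm_add_le ν σ).trans (by rw [hν])) 2
    have hnm : ‖ν - σ‖ ^ 2 ≤ (1 + ‖σ‖) ^ 2 :=
      pow_le_pow_left₀ (norm_nonneg _) ((norm_sub_le ν σ).trans (by rw [hν])) 2
    have h1 : |virialForm F ν σ| ≤ (|virialForm F (ν + σ) (ν + σ)| + |virialForm F (ν - σ) (ν - σ)|) / 4 := by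
      rw [show virialForm F ν σ = (virialForm F (ν + σ) (ν + σ) - virialForm F (ν - σ) (ν - σ)) / 4 by
        rw [virialForm_polar F ν σ]; ring, abs_div, abs_of_pos (by norm_num : (0 : ℝ) < 4)]
      exact div_le_div_of_nonneg_right (abs_sub _ _) (by norm_num)
    have h2 := mul_le_mul_of_nonneg_right hnp hcl
    have h3 := mul_le_mul_of_nonneg_right hnm hcl
    have h4 : (1 + ‖σ‖) ^ 2 * (c * ℓ ^ 3) = 2 * A * ℓ ^ 3 := by
      have hne : (1 + ‖σ‖) ^ 2 ≠ 0 := by positivity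
      rw [hc]
      field_simp
    linarith
  -- the main inequality tested against `v = σ`
  rw [real_inner_self_eq_norm_sq] at hmain
  have hsW : ‖σ‖ ^ 2 * W ≤ A * ℓ ^ 3 + ‖σ‖ * (P * ℓ ^ 3 / R + Q * ℓ ^ 2) := by
    have h1 := (abs_le.mp hmain).2
    have h2 := neg_abs_le (virialForm F ν σ)
    have h3 := mul_le_mul_of_nonneg_left hErr hs.le
    linarith [hWνσ]
  have hW3 : 3 * A * ℓ ^ 3 ≤ ‖σ‖ ^ 2 * W := by
    have h1 : 3 / 4 * (ℓ ^ 3 / 512) ≤ W := by linarith [hW1, hcard]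
    have h2 := mul_le_mul_of_nonneg_left h1 (sq_nonneg ‖σ‖)
    have e1 : 3 * (‖σ‖ ^ 2 / 2048) * ℓ ^ 3 = ‖σ‖ ^ 2 * (3 / 4 * (ℓ ^ 3 / 512)) := by ring
    rw [hA]
    linarith
  have hsP : ‖σ‖ * (P * ℓ ^ 3 / R) ≤ A * ℓ ^ 3 := by
    have e1 : ‖σ‖ * (P * ℓ ^ 3 / R) = ‖σ‖ * P / R * ℓ ^ 3 := by ring
    rw [e1]
    exact mul_le_mul_of_nonneg_right hRP (by positivity)
  have hfin : A * ℓ * ℓ ^ 2 ≤ ‖σ‖ * Q * ℓ ^ 2 := by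
    have e1 : A * ℓ * ℓ ^ 2 = A * ℓ ^ 3 := by ring
    have e2 : ‖σ‖ * (P * ℓ ^ 3 / R + Q * ℓ ^ 2) = ‖σ‖ * (P * ℓ ^ 3 / R) + ‖σ‖ * Q * ℓ ^ 2 := by ring
    linarith [hW3, hsW, hsP]
  have h5 : A * ℓ ≤ ‖σ‖ * Q := le_of_mul_le_mul_right hfin (by positivity)
  have h6 : ℓ ≤ ‖σ‖ * Q / A := by
    rw [le_div_iff₀ hApos]
    linarith
  linarith

end Summit.AtomisticToContinuum.Crystallization.Theorems.ChartedPlanarOrderGapStressVanishes
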